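import Summits.Ventures.Crystal3D.Theorems.StickyWulffConstantTextureBuildRiserLine
import HarnessLib

/-!
# TB-1: RISER GEOMETRY — the riser piece's hypotheses hold in clean co-axial material
# (lane T, crux `TextureLiminfV5`, stmt-Ventures-23912; `stub_TB_cover` repair census TB-1-g19 §1; ROUTE.md §73.3 (W1) «L-step», cf-p1's
# sketch HOME/cf-p1/route/lines/tex/StepGeometry.lean)

HONEST FRAMING. Venture `Summits/Ventures/Crystal3D` (cell `crystal3d-full`), route `route-Ventures-StickyWulffConstant`, helper `--supports` the
law-v5 crux `TextureLiminfV5` (stmt-Ventures-23912).  Elementary coordinate geometry of moved Barlow stackings (census-free, standard axioms).  No cover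
is built, no texture is built; rung F-C1 not moved.

WHY.  The riser piece of the v3 cover (…TextureBuildRiseredCover, p708390) carries three hypothesis fields per owned ball `b` — (c1) every ball touching
`b` lies in one of the three planes `⟪q − b, n⟫ ∈ {0, ±√(2/3)}`, (c2) the in-plane ones are in-plane SITES, `#sites ≤ 6` — which the cover's constructor
(`stub_TB_cover`) must discharge.  This file discharges them from ONE hypothesis of the intended situation, «every ball touching `b` lies on SOME moved
Barlow stacking with the common frame and origin `(L, s)`» (co-axial cleanliness: both column grains of a riser and everything near it share the layer
planes):
* `inner_sub_frameNormal_of_mem_stacking` — two sites of stackings with the same `(L, s)` (any two Hägg words) differ along `L e₃` by an INTEGER multiple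
  of the layer spacing `√(2/3)`;
* `inner_sub_frameNormal_cases_of_dist_eq_one` — if moreover they are at distance `1`, that multiple is `0` or `±1` (⇒ (c1));
* `three_mul_dist_sq_barlowPos_same_plane` — cf-p1's cross-word in-plane distance formula `3·dist² = a²(3(u² + uv + v² + d(u+v)) + d²)`;
* **`mem_stacking_of_inPlane_touch`** — L-STEP: an in-plane site of ANOTHER word at distance `1` from `b ∈ stacking L s σ` is a site of `stacking L s σ`
  (different registries of one layer are at in-plane distances `√(m + 1/3) ∌ 1`: `d² ≡ 0 (mod 3)` forces equal registry) (⇒ (c2));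
* `inPlaneSites L b` — the six in-plane neighbour sites as a `Finset` (`#≤ 6`), with `coe_inPlaneSites`: for `b ∈ stacking L s σ` it IS the set of
  in-plane sites at distance `1` (the integer equation `p² + pq + q² = 1` has exactly the six solutions) (⇒ `hrV6`, `Mesh₂.hBV`);
* **`riser_fields_of_clean`** — the three fields of `RiseredCover` for an owned set `own ⊆ stacking L s σL ∪ stacking L s σR`, from cleanliness.
WHAT THIS IS NOT: no riser piece is exhibited (which balls to own, where the boxes go is the constructor's business); F-C1 not moved.
-/

noncomputable section

namespace Summit.Ventures.Crystal3D.Theorems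

open Finset Summit.Ventures.Crystal3D
open scoped InnerProductSpace BigOperators
open Literature.MathematicalPhysics.StatisticalMechanics
open Summit.Ventures.Crystal3D.Cruxes.TextureLiminf.TexShadow (E3 stacking)

/-! ## Layer offsets along the frame normal -/

/-- the inner product with `single 2 1` is the third coordinate -/
theorem inner_single_two_eq_apply (r : E3) : ⟪r, (EuclideanSpace.single (2 : Fin 3) (1 : ℝ) : E3)⟫_ℝ = r 2 := by
  rw [EuclideanSpace.inner_single_right]; simp

/-- Two sites of moved Barlow stackings with the SAME frame and origin differ along the frame normal by an integer number of layer spacings. -/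
theorem inner_sub_frameNormal_of_mem_stacking (L : E3 ≃ₗᵢ[ℝ] E3) (s : E3) (σ σ' : ℤ → ℤ) {p q : E3}
    (hp : p ∈ stacking L s σ) (hq : q ∈ stacking L s σ') : ∃ m : ℤ, ⟪q - p, L (EuclideanSpace.single (2 : Fin 3) (1 : ℝ) : E3)⟫_ℝ = m * Real.sqrt (2 / 3) := by
  obtain ⟨r, ⟨k, i, j, rfl⟩, rfl⟩ := hp
  obtain ⟨r', ⟨k', i', j', rfl⟩, rfl⟩ := hq
  refine ⟨k' - k, ?_⟩
  have hsub : L (barlowPos 1 (Real.sqrt (2 / 3)) σ' k' i' j') + s - (L (barlowPos 1 (Real.sqrt (2 / 3)) σ k i j) + s) =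
      L (barlowPos 1 (Real.sqrt (2 / 3)) σ' k' i' j' - barlowPos 1 (Real.sqrt (2 / 3)) σ k i j) := by
    rw [map_sub]; abel
  rw [hsub, LinearIsometryEquiv.inner_map_map, inner_single_two_eq_apply]
  simp only [PiLp.sub_apply, barlowPos_apply_two]
  push_cast
  ring

/-- If moreover the two sites touch (`dist = 1`), the offset is `0` or `±√(2/3)` — field (c1) of the riser piece. -/
theorem inner_sub_frameNormal_cases_of_dist_eq_one (L : E3 ≃ₗᵢ[ℝ] E3) (s : E3) (σ σ' : ℤ → ℤ) {p q : E3}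
    (hp : p ∈ stacking L s σ) (hq : q ∈ stacking L s σ') (hd : dist p q = 1) :
    ⟪q - p, L (EuclideanSpace.single (2 : Fin 3) (1 : ℝ) : E3)⟫_ℝ = 0 ∨ ⟪q - p, L (EuclideanSpace.single (2 : Fin 3) (1 : ℝ) : E3)⟫_ℝ = Real.sqrt (2 / 3) ∨ ⟪q - p, L (EuclideanSpace.single (2 : Fin 3) (1 : ℝ) : E3)⟫_ℝ = -Real.sqrt (2 / 3) := by
  obtain ⟨m, hm⟩ := inner_sub_frameNormal_of_mem_stacking L s σ σ' hp hq
  have hle : |⟪q - p, L (EuclideanSpace.single (2 : Fin 3) (1 : ℝ) : E3)⟫_ℝ| ≤ 1 := by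
    calc |⟪q - p, L (EuclideanSpace.single (2 : Fin 3) (1 : ℝ) : E3)⟫_ℝ| ≤ ‖q - p‖ * ‖L (EuclideanSpace.single (2 : Fin 3) (1 : ℝ) : E3)‖ := abs_real_inner_le_norm _ _
      _ = 1 := by rw [LinearIsometryEquiv.norm_map, PiLp.norm_single, norm_one, mul_one, ← dist_eq_norm, dist_comm, hd]
  rw [hm] at hle ⊢
  have hs : Real.sqrt (2 / 3) ^ 2 = 2 / 3 := Real.sq_sqrt (by norm_num)
  have hspos : 0 < Real.sqrt (2 / 3) := Real.sqrt_pos.2 (by norm_num)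
  have habs : |(m : ℝ)| * Real.sqrt (2 / 3) ≤ 1 := by rwa [abs_mul, abs_of_pos hspos] at hle
  have hm2 : |(m : ℝ)| < 2 := by
    by_contra hcon
    have h2 : (2 : ℝ) ≤ |(m : ℝ)| := le_of_not_gt hcon
    nlinarith [hs, hspos, mul_le_mul_of_nonneg_right h2 hspos.le]
  have hlt := abs_lt.1 hm2
  have hmlt : m < 2 := by exact_mod_cast hlt.2
  have hmgt : -2 < m := by exact_mod_cast hlt.1
  have hmZ : m = 0 ∨ m = 1 ∨ m = -1 := by omega
  rcases hmZ with rfl | rfl | rfl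
  · left; simp
  · right; left; simp
  · right; right; simp

/-! ## L-step: different registries of one layer never touch in-plane -/

/-- **Cross-word in-plane distance formula** (cf-p1, StepGeometry): same frame, same layer index `k`, words `σ, σ'`,
`3·dist² = a²·(3(u² + uv + v² + d(u+v)) + d²)` with `u = i − i'`, `v = j − j'`, `d = haggLabel σ k − haggLabel σ' k`. -/
theorem three_mul_dist_sq_barlowPos_same_plane (a h : ℝ) (σ σ' : ℤ → ℤ) (k i j i' j' : ℤ) :
    3 * dist (barlowPos a h σ k i j) (barlowPos a h σ' k i' j') ^ 2 =
      a ^ 2 * ((3 * ((i - i') ^ 2 + (i - i') * (j - j') + (j - j') ^ 2 +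
        (haggLabel σ k - haggLabel σ' k) * ((i - i') + (j - j'))) +
        (haggLabel σ k - haggLabel σ' k) ^ 2 : ℤ) : ℝ) := by
  rw [EuclideanSpace.dist_sq_eq, Fin.sum_univ_three, Real.dist_eq, Real.dist_eq, Real.dist_eq,
    sq_abs, sq_abs, sq_abs, barlowPos_apply_zero, barlowPos_apply_zero, barlowPos_apply_one,
    barlowPos_apply_one, barlowPos_apply_two, barlowPos_apply_two]
  have h3 : (Real.sqrt 3 : ℝ) ^ 2 = 3 := Real.sq_sqrt (by norm_num)
  push_cast
  linear_combination (3 / 4 * a ^ 2 * ((j : ℝ) - j' + ((haggLabel σ k : ℝ) - haggLabel σ' k) / 3) ^ 2) * h3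

/-- If `3 ∣ d²` then `3 ∣ d`. -/
private theorem three_dvd_of_three_dvd_sq {d : ℤ} (h : (3 : ℤ) ∣ d ^ 2) : (3 : ℤ) ∣ d :=
  Int.Prime.dvd_pow' (by norm_num) h

/-- **L-STEP** (unit stacking, `a = 1`): a site of layer `k` of the word `σ'` at distance `1` from a site of layer `k` of the word `σ` has the same registry —
it is a site of the stacking with word `σ`.  (`3·1² = 3(…) + d²` forces `3 ∣ d`, and labels differing by `3q` give the same layer, re-indexed.) -/
theorem barlowPos_mem_of_same_plane_dist_eq_one (h : ℝ) (σ σ' : ℤ → ℤ) (k i j i' j' : ℤ)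
    (hd : dist (barlowPos 1 h σ k i j) (barlowPos 1 h σ' k i' j') = 1) :
    barlowPos 1 h σ' k i' j' ∈ barlowStacking 1 h σ := by
  have hf := three_mul_dist_sq_barlowPos_same_plane 1 h σ σ' k i j i' j'
  rw [hd] at hf
  set d : ℤ := haggLabel σ k - haggLabel σ' k with hdd
  have hint : (3 : ℤ) = 3 * ((i - i') ^ 2 + (i - i') * (j - j') + (j - j') ^ 2 + d * ((i - i') + (j - j'))) + d ^ 2 := by
    have : ((3 : ℤ) : ℝ) = ((3 * ((i - i') ^ 2 + (i - i') * (j - j') + (j - j') ^ 2 + d * ((i - i') + (j - j'))) + d ^ 2 : ℤ) : ℝ) := by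
      push_cast at hf ⊢; linarith
    exact_mod_cast this
  have h3d : (3 : ℤ) ∣ d := by
    apply three_dvd_of_three_dvd_sq
    exact ⟨1 - ((i - i') ^ 2 + (i - i') * (j - j') + (j - j') ^ 2 + d * ((i - i') + (j - j'))), by linarith⟩
  obtain ⟨q, hq⟩ := h3d
  -- labels differ by `3·(−q)`: same layer, re-indexed
  have hL : haggLabel σ' k = haggLabel σ k + 3 * (-q) := by rw [hdd] at hq; linarith
  rw [barlowPos_eq_of_haggLabel_eq 1 h i' j' hL]
  simp only [sub_self, zero_smul, add_zero]
  exact barlowPos_mem _ _ _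

/-- **L-STEP for moved stackings**: `b ∈ stacking L s σ`, `q ∈ stacking L s σ'` in the SAME layer plane (`⟪q − b, L e₃⟫ = 0`) at distance `1` ⇒
`q ∈ stacking L s σ` — field (c2) of the riser piece (with `V b` = the in-plane sites of `b`'s own stacking). -/
theorem mem_stacking_of_inPlane_touch (L : E3 ≃ₗᵢ[ℝ] E3) (s : E3) (σ σ' : ℤ → ℤ) {b q : E3}
    (hb : b ∈ stacking L s σ) (hq : q ∈ stacking L s σ') (hplane : ⟪q - b, L (EuclideanSpace.single (2 : Fin 3) (1 : ℝ) : E3)⟫_ℝ = 0) (hd : dist b q = 1) :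
    q ∈ stacking L s σ := by
  obtain ⟨r, ⟨k, i, j, rfl⟩, rfl⟩ := hb
  obtain ⟨r', ⟨k', i', j', rfl⟩, rfl⟩ := hq
  -- same layer index
  have hsub : L (barlowPos 1 (Real.sqrt (2 / 3)) σ' k' i' j') + s - (L (barlowPos 1 (Real.sqrt (2 / 3)) σ k i j) + s) =
      L (barlowPos 1 (Real.sqrt (2 / 3)) σ' k' i' j' - barlowPos 1 (Real.sqrt (2 / 3)) σ k i j) := by
    rw [map_sub]; abel
  rw [hsub, LinearIsometryEquiv.inner_map_map, inner_single_two_eq_apply] at hplane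
  simp only [PiLp.sub_apply, barlowPos_apply_two] at hplane
  have hspos : 0 < Real.sqrt (2 / 3) := Real.sqrt_pos.2 (by norm_num)
  have hkk : k' = k := by
    have : ((k' : ℝ) - k) * Real.sqrt (2 / 3) = 0 := by linarith
    rcases mul_eq_zero.1 this with h0 | h0
    · exact_mod_cast (sub_eq_zero.1 h0)
    · exact absurd h0 hspos.ne'
  subst hkk
  -- distance in the reference frame
  have hd' : dist (barlowPos 1 (Real.sqrt (2 / 3)) σ k' i j) (barlowPos 1 (Real.sqrt (2 / 3)) σ' k' i' j') = 1 := by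
    have h2 : L (barlowPos 1 (Real.sqrt (2 / 3)) σ k' i j) + s - (L (barlowPos 1 (Real.sqrt (2 / 3)) σ' k' i' j') + s) =
        L (barlowPos 1 (Real.sqrt (2 / 3)) σ k' i j - barlowPos 1 (Real.sqrt (2 / 3)) σ' k' i' j') := by rw [map_sub]; abel
    have hd2 := hd
    dsimp only at hd2
    rw [dist_eq_norm, h2, LinearIsometryEquiv.norm_map, ← dist_eq_norm] at hd2
    exact hd2
  exact ⟨_, barlowPos_mem_of_same_plane_dist_eq_one _ σ σ' k' i j i' j' hd', rfl⟩

/-! ## The six in-plane neighbour sites -/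

/-- the six in-plane lattice offsets `(±1,0), (0,±1), (1,−1), (−1,1)` -/
def hexOffsets : Finset (ℤ × ℤ) := {(1, 0), (-1, 0), (0, 1), (0, -1), (1, -1), (-1, 1)}

/-- the in-plane lattice vector with integer coordinates `(p, q)` in the unit triangular frame -/
def latVec (pq : ℤ × ℤ) : E3 := (pq.1 : ℝ) • triangularVec₁ 1 + (pq.2 : ℝ) • triangularVec₂ 1

/-- the six IN-PLANE NEIGHBOUR SITES of `b` in the frame `L` (as a `Finset`) -/
def inPlaneSites (L : E3 ≃ₗᵢ[ℝ] E3) (b : E3) : Finset E3 := hexOffsets.image fun pq => b + L (latVec pq)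

/-- There are at most six in-plane neighbour sites — field `hrV6` of the riser piece. -/
theorem card_inPlaneSites_le (L : E3 ≃ₗᵢ[ℝ] E3) (b : E3) : (inPlaneSites L b).card ≤ 6 :=
  (Finset.card_image_le).trans (by decide)

/-- Shifting the in-layer indices of `barlowPos` is adding the lattice vector. -/
theorem barlowPos_add_latVec (h : ℝ) (σ : ℤ → ℤ) (k i j p q : ℤ) :
    barlowPos 1 h σ k (i + p) (j + q) = barlowPos 1 h σ k i j + latVec (p, q) := by
  ext l
  fin_cases l <;> simp [latVec, triangularVec₁, triangularVec₂] <;> ring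

/-- The squared length of an in-plane lattice vector: `‖p u + q v‖² = p² + pq + q²`. -/
theorem norm_latVec_sq (pq : ℤ × ℤ) : ‖latVec pq‖ ^ 2 = ((pq.1 ^ 2 + pq.1 * pq.2 + pq.2 ^ 2 : ℤ) : ℝ) := by
  obtain ⟨p, q⟩ := pq
  have h := dist_barlowPos_sq 1 (1 : ℝ) constHagg 0 (0 + p) (0 + q) 0 0 0
  rw [barlowPos_add_latVec, dist_eq_norm, add_sub_cancel_left] at h
  rw [h]
  have h3 : (Real.sqrt 3 : ℝ) ^ 2 = 3 := Real.sq_sqrt (by norm_num)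
  push_cast
  linear_combination ((q : ℝ) ^ 2 / 4) * h3

/-- The lattice vectors of the six offsets have unit length. -/
theorem norm_latVec_eq_one {pq : ℤ × ℤ} (hpq : pq ∈ hexOffsets) : ‖latVec pq‖ = 1 := by
  have hsq : ‖latVec pq‖ ^ 2 = 1 := by
    rw [norm_latVec_sq]
    simp only [hexOffsets, Finset.mem_insert, Finset.mem_singleton] at hpq
    rcases hpq with rfl | rfl | rfl | rfl | rfl | rfl <;> norm_num
  nlinarith [norm_nonneg (latVec pq)]

/-- In-plane lattice vectors are orthogonal to `e₃`. -/
theorem inner_latVec_single_two (pq : ℤ × ℤ) : ⟪latVec pq, (EuclideanSpace.single (2 : Fin 3) (1 : ℝ) : E3)⟫_ℝ = 0 := by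
  rw [inner_single_two_eq_apply]
  simp [latVec, triangularVec₁, triangularVec₂]

/-- The integer equation `p² + pq + q² = 1` has exactly the six hexagonal solutions. -/
theorem mem_hexOffsets_of_eq_one {p q : ℤ} (h : p ^ 2 + p * q + q ^ 2 = 1) : (p, q) ∈ hexOffsets := by
  have hq : q ≤ 1 ∧ -1 ≤ q := by constructor <;> nlinarith [sq_nonneg (2 * p + q)]
  have hp : p ≤ 1 ∧ -1 ≤ p := by constructor <;> nlinarith [sq_nonneg (2 * q + p)]
  obtain ⟨hq1, hq2⟩ := hq
  obtain ⟨hp1, hp2⟩ := hp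
  interval_cases p <;> interval_cases q <;> simp_all [hexOffsets]

/-- **The in-plane sites of a stacking site ARE `inPlaneSites`**: for `b ∈ stacking L s σ`, a point is a site of that stacking in `b`'s layer plane at
distance `1` from `b` iff it is one of the six — the set identity required by `Mesh₂.hBV`. -/
theorem coe_inPlaneSites (L : E3 ≃ₗᵢ[ℝ] E3) (s : E3) (σ : ℤ → ℤ) {b : E3} (hb : b ∈ stacking L s σ) :
    (↑(inPlaneSites L b) : Set E3) = {v | v ∈ stacking L s σ ∧ dist b v = 1 ∧ ⟪v - b, L (EuclideanSpace.single (2 : Fin 3) (1 : ℝ) : E3)⟫_ℝ = 0} := by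
  obtain ⟨r, ⟨k, i, j, rfl⟩, rfl⟩ := hb
  ext v
  simp only [inPlaneSites, Finset.coe_image, Set.mem_image, Finset.mem_coe, Set.mem_setOf_eq]
  constructor
  · rintro ⟨pq, hpq, rfl⟩
    refine ⟨?_, ?_, ?_⟩
    · refine ⟨barlowPos 1 (Real.sqrt (2 / 3)) σ k (i + pq.1) (j + pq.2), barlowPos_mem _ _ _, ?_⟩
      dsimp only
      rw [barlowPos_add_latVec, Prod.mk.eta, map_add]; abel
    · rw [dist_eq_norm]
      have : L (barlowPos 1 (Real.sqrt (2 / 3)) σ k i j) + s - (L (barlowPos 1 (Real.sqrt (2 / 3)) σ k i j) + s + L (latVec pq)) =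
          -(L (latVec pq)) := by abel
      rw [this, norm_neg, LinearIsometryEquiv.norm_map, norm_latVec_eq_one hpq]
    · have : L (barlowPos 1 (Real.sqrt (2 / 3)) σ k i j) + s + L (latVec pq) - (L (barlowPos 1 (Real.sqrt (2 / 3)) σ k i j) + s) =
          L (latVec pq) := by abel
      rw [this, LinearIsometryEquiv.inner_map_map, inner_latVec_single_two]
  · rintro ⟨⟨r', ⟨k', i', j', rfl⟩, rfl⟩, hdist, hplane⟩
    -- same layer
    have hsub : L (barlowPos 1 (Real.sqrt (2 / 3)) σ k' i' j') + s - (L (barlowPos 1 (Real.sqrt (2 / 3)) σ k i j) + s) =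
        L (barlowPos 1 (Real.sqrt (2 / 3)) σ k' i' j' - barlowPos 1 (Real.sqrt (2 / 3)) σ k i j) := by
      rw [map_sub]; abel
    rw [hsub, LinearIsometryEquiv.inner_map_map, inner_single_two_eq_apply] at hplane
    simp only [PiLp.sub_apply, barlowPos_apply_two] at hplane
    have hspos : 0 < Real.sqrt (2 / 3) := Real.sqrt_pos.2 (by norm_num)
    have hkk : k' = k := by
      have : ((k' : ℝ) - k) * Real.sqrt (2 / 3) = 0 := by linarith
      rcases mul_eq_zero.1 this with h0 | h0
      · exact_mod_cast (sub_eq_zero.1 h0)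
      · exact absurd h0 hspos.ne'
    subst hkk
    -- the offset solves p² + pq + q² = 1
    have hd2 : dist (barlowPos 1 (Real.sqrt (2 / 3)) σ k' i j) (barlowPos 1 (Real.sqrt (2 / 3)) σ k' i' j') = 1 := by
      have h2 : L (barlowPos 1 (Real.sqrt (2 / 3)) σ k' i j) + s - (L (barlowPos 1 (Real.sqrt (2 / 3)) σ k' i' j') + s) =
          L (barlowPos 1 (Real.sqrt (2 / 3)) σ k' i j - barlowPos 1 (Real.sqrt (2 / 3)) σ k' i' j') := by rw [map_sub]; abel
      rw [dist_eq_norm, h2, LinearIsometryEquiv.norm_map, ← dist_eq_norm] at hdist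
      exact hdist
    have hf := three_mul_dist_sq_barlowPos_same_plane 1 (Real.sqrt (2 / 3)) σ σ k' i j i' j'
    rw [hd2, sub_self] at hf
    have heq : (i - i') ^ 2 + (i - i') * (j - j') + (j - j') ^ 2 = 1 := by
      have : (((i - i') ^ 2 + (i - i') * (j - j') + (j - j') ^ 2 : ℤ) : ℝ) = 1 := by push_cast at hf ⊢; linarith
      exact_mod_cast this
    have heq' : (i' - i) ^ 2 + (i' - i) * (j' - j) + (j' - j) ^ 2 = 1 := by linarith [heq]
    refine ⟨(i' - i, j' - j), mem_hexOffsets_of_eq_one heq', ?_⟩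
    have hij : barlowPos 1 (Real.sqrt (2 / 3)) σ k' i' j' = barlowPos 1 (Real.sqrt (2 / 3)) σ k' (i + (i' - i)) (j + (j' - j)) := by
      congr 1 <;> ring
    rw [hij]
    dsimp only
    rw [barlowPos_add_latVec, map_add]
    abel

/-! ## The riser piece's fields from co-axial cleanliness -/

/-- **The three hypothesis fields of a riser piece hold in clean co-axial material.**  If the owned balls lie on the two column stackings
`stacking L s σL ∪ stacking L s σR` and every configuration ball touching an owned ball lies on SOME stacking with the same frame and origin, then with
`n := L e₃` and `V b := inPlaneSites L b`: `#V b ≤ 6`, (c1) touching balls lie in the three planes, (c2) in-plane touching balls are in `V b`. -/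
theorem riser_fields_of_clean (L : E3 ≃ₗᵢ[ℝ] E3) (s : E3) (σL σR : ℤ → ℤ) (own X' : Finset E3)
    (hown : ∀ b ∈ own, b ∈ stacking L s σL ∨ b ∈ stacking L s σR)
    (hclean : ∀ b ∈ own, ∀ q ∈ X', dist b q = 1 → ∃ σ' : ℤ → ℤ, q ∈ stacking L s σ') :
    (∀ b ∈ own, (inPlaneSites L b).card ≤ 6) ∧
    (∀ b ∈ own, ∀ q ∈ X', dist b q = 1 →
      ⟪q - b, L (EuclideanSpace.single (2 : Fin 3) (1 : ℝ) : E3)⟫_ℝ = 0 ∨ ⟪q - b, L (EuclideanSpace.single (2 : Fin 3) (1 : ℝ) : E3)⟫_ℝ = Real.sqrt (2 / 3) ∨ ⟪q - b, L (EuclideanSpace.single (2 : Fin 3) (1 : ℝ) : E3)⟫_ℝ = -Real.sqrt (2 / 3)) ∧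
    (∀ b ∈ own, ∀ q ∈ X', dist b q = 1 → ⟪q - b, L (EuclideanSpace.single (2 : Fin 3) (1 : ℝ) : E3)⟫_ℝ = 0 → q ∈ inPlaneSites L b) := by
  refine ⟨fun b _ => card_inPlaneSites_le L b, fun b hb q hq hd => ?_, fun b hb q hq hd hplane => ?_⟩
  · obtain ⟨σ', hq'⟩ := hclean b hb q hq hd
    rcases hown b hb with h | h
    · exact inner_sub_frameNormal_cases_of_dist_eq_one L s σL σ' h hq' hd
    · exact inner_sub_frameNormal_cases_of_dist_eq_one L s σR σ' h hq' hd
  · obtain ⟨σ', hq'⟩ := hclean b hb q hq hd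
    rcases hown b hb with h | h
    · have hmem := mem_stacking_of_inPlane_touch L s σL σ' h hq' hplane hd
      rw [← Finset.mem_coe, coe_inPlaneSites L s σL h]
      exact ⟨hmem, hd, hplane⟩
    · have hmem := mem_stacking_of_inPlane_touch L s σR σ' h hq' hplane hd
      rw [← Finset.mem_coe, coe_inPlaneSites L s σR h]
      exact ⟨hmem, hd, hplane⟩

end Summit.Ventures.Crystal3D.Theorems

end
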